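import Literature.Combinatorics.LorentzianPolynomials.IndependentSets
import HarnessLib

/-!
# The homogenised independence polynomial `f_M = Σ_{I ∈ 𝓘(M)} w^I w_0^{n-|I|}` of a matroid, and what its Lorentzian
# property reduces to (Brändén–Huh 2020, §4.3, proof of Thm. 4.14; §2.4 Thm. 2.25 / Def. 2.6)

Layer `Literature/Combinatorics/LorentzianPolynomials`, namespace `Literature.Combinatorics.LorentzianPolynomials`;
lane `lit-hodgefound` (Track 2 foundations library), seat p16, generation 27 (row g27-#21). Builds on `IndependentSets.lean`
(`homIndSet`, `indepExp M`, `isMConvex_indepExp`) and `MatroidBases.lean` (`genPoly`).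

## Source (verbatim) — P. Brändén, J. Huh, *Lorentzian polynomials* [BrandenHuh2019] (held `paper:arxiv-1902.03719`)

§4.3, proof of Thm. 4.14 (Mason's conjecture): "Here we deduce Theorem 4.14 from the Lorentzian property of
`f_M(w_0, w_1, …, w_n) = Σ_{A ∈ 𝓘(M)} w^A w_0^{n-|A|}`, `w = (w_1, …, w_n)`, where `𝓘(M)` is the collection of independent
sets of `M`. *Proof of Theorem 4.14.* The polynomial `f_M` is Lorentzian by Theorem 4.10 and the identity
`f_M(w_0, w_1, …, w_n) = lim_{q → 0} Z_{q,M}(w_0, q w_1, …, q w_n)`." §2.2 Def. 2.6 / §2.4 Thm. 2.25: `L^d_n` is the set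
of degree-`d` homogeneous polynomials with nonnegative coefficients whose support is M-convex and such that
`∂^α f` has at most one positive eigenvalue for every `α ∈ Δ^{d-2}_n`.

## What is here (`σ` a finite type, `n = |σ|`, `M : Matroid σ`, variables `Option σ` with `w_0 = none`)

* `indepGenPoly M = f_M = Σ_{I ∈ 𝓘(M)} w^I w_0^{n-|I|}` (as `genPoly (indepExp M)`), `coeff_indepGenPoly`
  (`= [β = e^♮_I, I independent]`), `support_indepGenPoly = indepExp M`, `isHomogeneous_indepGenPoly` (degree `n`),
  `coeff_indepGenPoly_nonneg`, `indepGenPoly_ne_zero`, `coeff_indepGenPoly_homIndSet`;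
* `factorialProd_homIndSet` (`(e^♮_I)! = (n - |I|)!`) and `normCoeff_indepGenPoly` (the normalised coefficients
  `β! · coeff_β f_M = [β ∈ indepExp M] · (β_0)!`);
* **`indepGenPoly_mem_lorentzian_iff`**: by Def. 2.6 / Thm. 2.25 and the M-convexity of `supp f_M` (`isMConvex_indepExp`),
  `f_M ∈ L^n_{Option σ}` iff for every `α ∈ Δ^{n-2}` the symmetric matrix `(normCoeff (α + e_i + e_j) f_M)_{i,j}` has at
  most one positive eigenvalue — the statement that remains to be proved for "`f_M` is Lorentzian" (Thm. 4.10 at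
  `q → 0`), isolated here; and the degenerate cases `n ≤ 1` (`indepGenPoly_mem_lorentzian_of_card_le_one`).

One definition with body (`indepGenPoly`), theorems otherwise; no `sorry`, no named fact.
-- TODO(general form): `f_M ∈ L^n_{n+1}` (the Hessian signatures, Brändén–Huh Thm. 4.10 / [BH18]).

## References

* [BrandenHuh2019] P. Brändén, J. Huh, *Lorentzian polynomials*, Ann. of Math. (2) 192 (2020) 821–891, arXiv:1902.03719 —
  §4.3 (proof of Thm. 4.14), §2.2 Def. 2.6, §2.4 Thm. 2.25.
-/

noncomputable section

open MvPolynomial Finsupp Finset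
open scoped Nat

namespace Literature.Combinatorics.LorentzianPolynomials

variable {σ : Type*} [Fintype σ]

/-! ## §1 The polynomial `f_M` -/

section Def

/-- **The homogenised independence polynomial `f_M = Σ_{I ∈ 𝓘(M)} w^I w_0^{n-|I|}`** of a matroid `M` on the finite type
`σ` (`n = |σ|`), in the variables `Option σ` (`w_0 = none`): the generating polynomial of `indepExp M`.
[cite: BrandenHuh2019, §4.3 proof of Thm. 4.14 ("`f_M(w_0, w_1, …, w_n) = Σ_{A ∈ 𝓘(M)} w^A w_0^{n-|A|}`")] -/
def indepGenPoly (M : Matroid σ) : MvPolynomial (Option σ) ℝ := genPoly (indepExp M)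

/-- `f_M = Σ_{α ∈ indepExp M} w^α`. [cite: BrandenHuh2019, §4.3 proof of Thm. 4.14] -/
theorem indepGenPoly_def (M : Matroid σ) : indepGenPoly M = ∑ α ∈ indepExp M, monomial α 1 := rfl

variable [DecidableEq σ]

/-- The coefficients of `f_M`: `coeff_β f_M = [β ∈ indepExp M]`. [cite: BrandenHuh2019, §4.3 proof of Thm. 4.14] -/
theorem coeff_indepGenPoly (M : Matroid σ) (β : Option σ →₀ ℕ) :
    coeff β (indepGenPoly M) = if β ∈ indepExp M then 1 else 0 := by
  rw [indepGenPoly, coeff_genPoly]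

/-- `coeff_{e^♮_I} f_M = [I independent]`. [cite: BrandenHuh2019, §4.3 proof of Thm. 4.14] -/
theorem coeff_indepGenPoly_homIndSet (M : Matroid σ) (I : Set σ) [Decidable (M.Indep I)] :
    coeff (homIndSet I) (indepGenPoly M) = if M.Indep I then 1 else 0 := by
  rw [coeff_indepGenPoly]
  exact if_congr homIndSet_mem_indepExp rfl rfl

/-- The coefficients of `f_M` are nonnegative. [cite: BrandenHuh2019, §4.3 proof of Thm. 4.14; §2.2 Def. 2.6] -/
theorem coeff_indepGenPoly_nonneg (M : Matroid σ) (β : Option σ →₀ ℕ) : 0 ≤ coeff β (indepGenPoly M) :=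
  coeff_genPoly_nonneg _ β

/-- `supp f_M = indepExp M`. [cite: BrandenHuh2019, §4.3 proof of Thm. 4.14] -/
theorem support_indepGenPoly (M : Matroid σ) :
    {β : Option σ →₀ ℕ | coeff β (indepGenPoly M) ≠ 0} = (indepExp M : Set (Option σ →₀ ℕ)) :=
  support_genPoly _

omit [DecidableEq σ] in
/-- `f_M` is homogeneous of degree `n = |σ|`. [cite: BrandenHuh2019, §4.3 proof of Thm. 4.14 ("`w^A w_0^{n-|A|}`")] -/
theorem isHomogeneous_indepGenPoly (M : Matroid σ) : (indepGenPoly M).IsHomogeneous (Fintype.card σ) :=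
  isHomogeneous_genPoly fun _ hα ↦ degree_eq_of_mem_indepExp hα

/-- `f_M ≠ 0` (the empty set is independent: the monomial `w_0^n` occurs). [cite: BrandenHuh2019, §4.3 proof of Thm. 4.14] -/
theorem indepGenPoly_ne_zero (M : Matroid σ) : indepGenPoly M ≠ 0 := fun h ↦ by
  classical
  have hc := coeff_indepGenPoly_homIndSet M ∅
  rw [h, coeff_zero, if_pos M.empty_indep] at hc
  exact zero_ne_one hc

end Def

/-! ## §2 Normalised coefficients -/

section NormCoeff

/-- `(e^♮_I)! = (n - |I|)!` (the only exponent larger than `1` is that of `w_0`).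
[cite: BrandenHuh2019, §2.2 (p. 11, "`α! = Π_i α_i!`"); §4.3 proof of Thm. 4.14] -/
theorem factorialProd_homIndSet (I : Set σ) : factorialProd (homIndSet I) = ((Fintype.card σ - I.ncard)! : ℝ) := by
  rw [factorialProd, Fintype.prod_option, homIndSet_none]
  simp_rw [homIndSet_some]
  have h : ∏ i : σ, (((indSet I) i)! : ℝ) = 1 := Finset.prod_eq_one fun i _ ↦ by
    have hi := indSet_le_one I i
    interval_cases (indSet I) i <;> simp
  rw [h, mul_one]

variable [DecidableEq σ]

/-- **The normalised coefficients of `f_M`**: `β! · coeff_β f_M = [β ∈ indepExp M] · (β_0)!`.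
[cite: BrandenHuh2019, §2.2 (p. 11, normalised coefficients); §4.3 proof of Thm. 4.14] -/
theorem normCoeff_indepGenPoly (M : Matroid σ) (β : Option σ →₀ ℕ) :
    normCoeff β (indepGenPoly M) = if β ∈ indepExp M then ((β none)! : ℝ) else 0 := by
  rw [normCoeff, coeff_indepGenPoly]
  split_ifs with h
  · obtain ⟨I, -, rfl⟩ := mem_indepExp.1 h
    rw [factorialProd_homIndSet, homIndSet_none, mul_one]
  · rw [mul_zero]

/-- In particular `(e^♮_I)! · coeff f_M = (n - |I|)!` for `I` independent. [cite: BrandenHuh2019, §4.3 proof of Thm. 4.14] -/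
theorem normCoeff_indepGenPoly_homIndSet {M : Matroid σ} {I : Set σ} (hI : M.Indep I) :
    normCoeff (homIndSet I) (indepGenPoly M) = ((Fintype.card σ - I.ncard)! : ℝ) := by
  rw [normCoeff_indepGenPoly, if_pos (homIndSet_mem_indepExp.2 hI), homIndSet_none]

end NormCoeff

/-! ## §3 What "`f_M` is Lorentzian" reduces to -/

section Reduction

variable [DecidableEq σ]

/-- The three "easy" conditions of Def. 2.6 for `f_M`: homogeneous of degree `n`, nonnegative coefficients, M-convex
support (`isMConvex_indepExp`). [cite: BrandenHuh2019, §2.2 Def. 2.6; §2.4 Lemma 2.21; §4.3 proof of Thm. 4.14] -/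
theorem indepGenPoly_easy (M : Matroid σ) :
    (indepGenPoly M).IsHomogeneous (Fintype.card σ) ∧ (∀ β, 0 ≤ coeff β (indepGenPoly M)) ∧
      IsMConvex {β : Option σ →₀ ℕ | coeff β (indepGenPoly M) ≠ 0} :=
  ⟨isHomogeneous_indepGenPoly M, coeff_indepGenPoly_nonneg M, by rw [support_indepGenPoly]; exact isMConvex_indepExp M⟩

/-- **`f_M ∈ L^n` iff the Hessians of its `(n-2)`-nd derivatives have at most one positive eigenvalue.** By Def. 2.6 /
Thm. 2.25 (in the lane's normalised-coefficient form `mem_lorentzian_iff_forall_sigPos_normCoeff`), since `f_M` is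
homogeneous of degree `n` with nonnegative coefficients and M-convex support, `f_M` is Lorentzian iff for every
`α ∈ Δ^{n-2}_{Option σ}` the matrix `((α + e_i + e_j)! · coeff_{α+e_i+e_j} f_M)_{i,j}` has at most one positive eigenvalue.
This is the remaining content of "The polynomial `f_M` is Lorentzian by Theorem 4.10".
[cite: BrandenHuh2019, §4.3 proof of Thm. 4.14; §2.2 Def. 2.6; §2.4 Thm. 2.25] -/
theorem indepGenPoly_mem_lorentzian_iff (M : Matroid σ) {m : ℕ} (hm : Fintype.card σ = m + 2) :
    indepGenPoly M ∈ lorentzian (Option σ) (Fintype.card σ) ↔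
      ∀ α : Option σ →₀ ℕ, α.degree = m → sigPos (Matrix.toBilin'
        (Matrix.of fun i j ↦ normCoeff (α + Finsupp.single i 1 + Finsupp.single j 1) (indepGenPoly M))).toQuadraticMap ≤ 1 := by
  rw [hm, mem_lorentzian_iff_forall_sigPos_normCoeff, and_iff_right (hm ▸ indepGenPoly_easy M)]

/-- The same with the normalised coefficients made explicit: the `(i,j)` entry is
`[α + e_i + e_j ∈ indepExp M] · ((α + e_i + e_j)_0)!`. [cite: BrandenHuh2019, §4.3 proof of Thm. 4.14; §2.4 Thm. 2.25] -/
theorem indepGenPoly_mem_lorentzian_iff' (M : Matroid σ) {m : ℕ} (hm : Fintype.card σ = m + 2) :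
    indepGenPoly M ∈ lorentzian (Option σ) (Fintype.card σ) ↔
      ∀ α : Option σ →₀ ℕ, α.degree = m → sigPos (Matrix.toBilin' (Matrix.of fun i j ↦
        if α + Finsupp.single i 1 + Finsupp.single j 1 ∈ indepExp M then
          (((α + Finsupp.single i 1 + Finsupp.single j 1 : Option σ →₀ ℕ) none)! : ℝ) else 0)).toQuadraticMap ≤ 1 := by
  rw [indepGenPoly_mem_lorentzian_iff M hm]
  simp_rw [normCoeff_indepGenPoly]

/-- **The degenerate cases `n ≤ 1`**: then `f_M` is Lorentzian outright (degree `≤ 1`: Def. 2.6 asks only for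
homogeneity and nonnegative coefficients). [cite: BrandenHuh2019, §2.2 Def. 2.6 (`L^0_n`, `L^1_n`)] -/
theorem indepGenPoly_mem_lorentzian_of_card_le_one (M : Matroid σ) (h : Fintype.card σ ≤ 1) :
    indepGenPoly M ∈ lorentzian (Option σ) (Fintype.card σ) := by
  rcases Nat.le_one_iff_eq_zero_or_eq_one.1 h with h0 | h1
  · rw [h0]
    exact mem_lorentzian_zero.2 ⟨h0 ▸ isHomogeneous_indepGenPoly M, coeff_indepGenPoly_nonneg M⟩
  · rw [h1]
    exact mem_lorentzian_one.2 ⟨h1 ▸ isHomogeneous_indepGenPoly M, coeff_indepGenPoly_nonneg M⟩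

end Reduction

end Literature.Combinatorics.LorentzianPolynomials

end
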